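import Literature.AlgebraicGeometry.ModuliOfAbelianVarieties.SiegelFamilyNoetherLefschetzTwistedProduct
import Literature.Geometry.Kaehler.ComplexTorusComplementaryPairTwistedProduct
import HarnessLib

/-!
# `NL_{g,δ}` is the image of Debarre's twisted products: every point of `NL_{g,δ}` is a `(Y × Z)/graph(p)`
# (Iribar López 2024, Lemma 10 (last assertion) and Definition 4, read on `𝔥_g`)

Layer `Literature/AlgebraicGeometry/ModuliOfAbelianVarieties`, namespace
`Literature.AlgebraicGeometry.ModuliOfAbelianVarieties.SiegelModuli`; lane `lit-hodgefound` (Track 2 foundations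
library, Layer A4), seat `lit-hodgefound-skel-4` (gen 26), row **A4-76**, FILE E.  Sequel of
`SiegelFamilyNoetherLefschetzTwistedProduct.lean` (FILE C: a twisted product `((Y × Z)/graph(p), θ_p)` with
`θ_Y` of type `δ` gives a point of `NL_{g,δ} ∩ NL_{g,δ'}` — the inclusion `image(𝒫_{g,δ}) ⊆ NL_{g,δ}`) and of the
Kähler-layer `ComplexTorusComplementaryPairTwistedProduct.lean` (FILE D: every principally polarised torus with a
complementary pair `(Y, Z)` is, as a POLARISED torus, a twisted product `((Y × Z)/graph(p), θ_p)` for an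
antisymplectic isomorphism `p : K(θ_Y) ≅ K(θ_Z)` — Lemma 10's «all principally polarized abelian varieties having
`Y` and `Z` as complementary subvarieties arise this way»).

## What is here

Iribar López [§2.2 Def. 4, p. 8] defines `𝒫_{g,δ} : 𝒜^{lev}_{u,δ} × 𝒜^{lev}_{g−u,δ̃} → 𝒜_g`,
`((Y, θ_Y, f_Y), (Z, θ_Z, f_Z)) ↦ ((Y × Z)/graph(f_Z ∘ r ∘ f_Y⁻¹), θ)`, and records [§2.2 after Def. 4, p. 8]:
«By Lemma 10, `𝒫_{g,δ}` is surjective onto the locus of principally polarized abelian varieties having a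
subvariety whose induced type is of type `δ`» — that locus being `NL_{g,δ}` [§1.2, p. 3].  On the period domain
`𝔥_g` (the tree's `nlLocusType g δ` of `SiegelFamilyNoetherLefschetzInducedType.lean`) this is the statement
proved here:

* `exists_isPolarizedIso_quotientBy_graphSubgroup_of_mem_nlLocusType` (§1): for `W ∈ NL_{g,δ}` there are a
  lattice subspace `V` (complex for `Φ_W`, so `Y = π(V)` is an abelian subvariety of `X_W` and `Z = π(V^⊥)` its
  complementary one), integer Gram matrices of the induced polarisations `θ_Y = ι_Y^*E_W`, `θ_Z = ι_Z^*E_W`, a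
  BIJECTIVE ANTISYMPLECTIC `p : K(θ_Y) → K(θ_Z)` and an isomorphism of polarised tori
  `(X_W, E_W) ≅ ((Y × Z)/graph(p), θ_p)` (`θ_p` Debarre's descended `θ_Y ⊠ θ_Z` of
  `ComplexTorusAntisymplecticGraphQuotient.lean`), with `(Y, θ_Y)` of type `δ` — i.e.
  `NL_{g,δ} ⊆ image(𝒫_{g,δ})`;
* `exists_isPolarizedIso_quotientBy_graphSubgroup_of_mem_nlLocusType_compl` (§2): for `2u ≤ g` the second
  factor `(Z, θ_Z)` is of the complementary type `δ̃ = (1, …, 1, d₁, …, d_u)` (`g − 2u` ones) — the domain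
  `𝒜_{u,δ} × 𝒜_{g−u,δ̃}` of `𝒫_{g,δ}` as printed («if `θ|_Y` is of type `(d₁, …, d_u)` then `θ|_Z` is of type
  `δ̃`», §2.2 p. 7, Lange Cor. 5.3.5);
* `mem_nlLocusType_iff_exists_isPolarizedIso_quotientBy_graphSubgroup` (§3): the two inclusions assembled —
  `W ∈ NL_{g,δ}` iff `(X_W, E_W)` is isomorphic, as a polarised torus, to a twisted product
  `((Y × Z)/graph(p), θ_p)` over a complementary pair `(Y, Z) = (π(V), π(V^⊥))` of `X_W` with `θ_Y` of type `δ`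
  («`NL_{g,δ}` = image of `𝒫_{g,δ}`», with FILE C's `mem_nlLocusType_of_isPolarizedIso_quotientBy_graphSubgroup`
  for `⊇`).

Scope (what is NOT here): the tori `Y`, `Z` produced are the abelian subvarieties `π(V)`, `π(V^⊥)` of `X_W`
itself with their sub-torus structures `subtorusPeriod`; the ABSTRACT surjectivity of `𝒫_{g,δ}` on
`𝒜_{u,δ} × 𝒜_{g−u,δ̃}` modulo isomorphism (any abstract pair `((Y, θ_Y), (Z, θ_Z))` of complementary types
admits an antisymplectic `K(θ_Y) ≅ K(θ_Z)`, Iribar López's `r : K(δ) → K(δ̃)` composed with level structures)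
and the independence of the isomorphism type from `p` (Lemma 10, «does not depend on `p`») are not formalised
in this row.

## Method

§1 is FILE D's `IsPrincipalPolarization.exists_antisymplectic_isPolarizedIso_quotientBy_graphSubgroup'` applied
to the principally polarised Siegel torus `(X_W, E_W)` (`isPrincipalPolarization_prinForm`) and the subspace `V`
witnessing `W ∈ NL_{g,δ}`; the integer Gram matrices exist by `IsRiemannForm.exists_intMatrix_latticeGram` for
the restricted Riemann forms (`isRiemannForm_restrict`), and the type of `(Y, θ_Y)` is the type of `E_W|_V`
(`IsSubPolarizationType.isPolarizationType_subtorusPeriod`).  §2 adds Lange's Cor. 5.3.5 in the tree's form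
`IsPrincipalPolarization.exists_isSubPolarizationType_compl` + uniqueness of types, exactly as in
`nlLocusType_subset_nlLocusType_append`.  §3 combines §1 with FILE C.  No new definitions, no named facts.

## References

* [IribarLopez2024NoetherLefschetzCycles] A. Iribar López, *Noether–Lefschetz cycles on the moduli space of
  abelian varieties*, arXiv:2411.09910 (2024), §1.2 (p. 3: `NL_{g,δ}`), §2.2 Lemma 10 and Definition 4
  (pp. 7–8: `𝒫_{g,δ}`, «`𝒫_{g,δ}` is surjective onto the locus …»).
* [Auffarth2016NonSimplePPAV] R. Auffarth, *A structure theorem for non-simple principally polarized abelian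
  varieties*, Math. Z. 282 (2016), §3 (Debarre's morphism `Φ_{u,n−u}(D)` is surjective onto `𝒜^D_{u,n−u}`).
* [Debarre1988ThetaSingulierCodim3] O. Debarre, *Sur les variétés abéliennes dont le diviseur thêta est
  singulier en codimension 3*, Duke Math. J. 57 (1988) (the original construction).
* [Lange2023AbelianVarietiesComplex] H. Lange, *Abelian Varieties over the Complex Numbers* (2023), §3.1.1
  Thm. 3.1.2 (p. 158), §5.3.1 Cor. 5.3.4–5.3.5, Lemma 5.3.6 (p. 263).
-/

noncomputable section

open Matrix Module Function Set

namespace Literature.AlgebraicGeometry.ModuliOfAbelianVarieties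

namespace SiegelModuli

open Literature.NumberTheory.Automorphic (siegelUpperHalfSpace)
open Literature.NumberTheory.ModularForms.SiegelUpperHalfSpace
open Literature.Geometry.Kaehler Literature.Geometry.Kaehler.ComplexTorus

variable {g u : ℕ}

/-! ## §1 `NL_{g,δ} ⊆ image(𝒫_{g,δ})`: a point of `NL_{g,δ}` is a twisted product `(Y × Z)/graph(p)` with
`θ_Y` of type `δ` -/

/-- **Iribar López 2024, Lemma 10 / Def. 4: every point of `NL_{g,δ}` is a Debarre twisted product.**  If
`W ∈ NL_{g,δ}` — `X_W` has an abelian subvariety `Y = π(V)` with `E_W|_Y` of type `δ` — then, with `Z = π(V^⊥)`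
the complementary abelian subvariety, `θ_Y = ι_Y^*E_W`, `θ_Z = ι_Z^*E_W` the induced polarisations (integer Gram
matrices `G_Y`, `G_Z` on the lattices `Λ ∩ V`, `Λ ∩ V^⊥`), there are a bijective ANTISYMPLECTIC homomorphism
`p : K(θ_Y) → K(θ_Z)` of the Weil pairings (finite graph) and an isomorphism of POLARISED tori
`(X_W, E_W) ≅ ((Y × Z)/graph(p), θ_p)`, and `(Y, θ_Y)` is of type `δ`: «`𝒫_{g,δ}` is surjective onto the locus of
principally polarized abelian varieties having a subvariety whose induced type is of type `δ`».
[cite: IribarLopez2024NoetherLefschetzCycles, §2.2 Lemma 10 (last assertion) and Def. 4 with the sentence following it (pp. 7–8); §1.2 (p. 3)] [cite: Auffarth2016NonSimplePPAV, §3 (surjectivity of `Φ_{u,n−u}(D)`)] [cite: Lange2023AbelianVarietiesComplex, §5.3.1 Cor. 5.3.4, Lemma 5.3.6 (p. 263)] -/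
theorem exists_isPolarizedIso_quotientBy_graphSubgroup_of_mem_nlLocusType {δ : Fin u → ℕ}
    {W : siegelUpperHalfSpace g} (hW : W ∈ nlLocusType g δ) :
    ∃ (V : Submodule ℝ (Fin g ⊕ Fin g → ℝ)) (hV : IsLatticeSubspace V) (hVc : IsComplexSubspace (prinPeriod W) V)
      (hVo : IsLatticeSubspace (orthSubspace (prinPeriod W) (prinForm W) V))
      (hVoc : IsComplexSubspace (prinPeriod W) (orthSubspace (prinPeriod W) (prinForm W) V))
      (GY : Matrix (Fin (subRank V)) (Fin (subRank V)) ℤ)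
      (GZ : Matrix (Fin (subRank (orthSubspace (prinPeriod W) (prinForm W) V)))
        (Fin (subRank (orthSubspace (prinPeriod W) (prinForm W) V))) ℤ)
      (_ : GY.map (Int.cast : ℤ → ℝ) = latticeGram (subtorusPeriod (prinPeriod W) V hV hVc)
        (pullbackForm (cxSpan (prinPeriod W) V).subtypeL (prinForm W)))
      (_ : GZ.map (Int.cast : ℤ → ℝ) =
        latticeGram (subtorusPeriod (prinPeriod W) (orthSubspace (prinPeriod W) (prinForm W) V) hVo hVoc)
          (pullbackForm (cxSpan (prinPeriod W) (orthSubspace (prinPeriod W) (prinForm W) V)).subtypeL (prinForm W)))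
      (p : kerPhiH (subtorusPeriod (prinPeriod W) V hV hVc) GY →+
        kerPhiH (subtorusPeriod (prinPeriod W) (orthSubspace (prinPeriod W) (prinForm W) V) hVo hVoc) GZ)
      (_ : Bijective p)
      (_ : IsAntisymplectic (pullbackForm (cxSpan (prinPeriod W) V).subtypeL (prinForm W))
        (pullbackForm (cxSpan (prinPeriod W) (orthSubspace (prinPeriod W) (prinForm W) V)).subtypeL (prinForm W)) p)
      (_ : Finite (graphSubgroup _ _ p))
      (h : ComplexTorus (prinPeriod W) ≃+
        ComplexTorus (quotientByPeriod (prodPeriod (subtorusPeriod (prinPeriod W) V hV hVc)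
          (subtorusPeriod (prinPeriod W) (orthSubspace (prinPeriod W) (prinForm W) V) hVo hVoc))
          (graphSubgroup _ _ p))),
      IsPolarizedIso (prinPeriod W) (prinForm W)
          (quotientByPeriod (prodPeriod (subtorusPeriod (prinPeriod W) V hV hVc)
            (subtorusPeriod (prinPeriod W) (orthSubspace (prinPeriod W) (prinForm W) V) hVo hVoc))
            (graphSubgroup _ _ p))
          (prodForm (pullbackForm (cxSpan (prinPeriod W) V).subtypeL (prinForm W))
            (pullbackForm (cxSpan (prinPeriod W) (orthSubspace (prinPeriod W) (prinForm W) V)).subtypeL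
              (prinForm W))) h ∧
        ComplexTorus.IsPolarizationType (subtorusPeriod (prinPeriod W) V hV hVc)
          (pullbackForm (cxSpan (prinPeriod W) V).subtypeL (prinForm W)) δ := by
  obtain ⟨V, hV, hVc, hd⟩ := hW
  have hP := isPrincipalPolarization_prinForm W
  have hη := hP.isRiemannForm
  have hVo : IsLatticeSubspace (orthSubspace (prinPeriod W) (prinForm W) V) :=
    isLatticeSubspace_orthSubspace _ hη hV hVc
  have hVoc : IsComplexSubspace (prinPeriod W) (orthSubspace (prinPeriod W) (prinForm W) V) :=
    isComplexSubspace_orthSubspace _ hη.1 hVc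
  obtain ⟨GY, hGY⟩ := (isRiemannForm_restrict _ hη hV hVc).exists_intMatrix_latticeGram
  obtain ⟨GZ, hGZ⟩ := (isRiemannForm_restrict _ hη hVo hVoc).exists_intMatrix_latticeGram
  obtain ⟨p, hpb, ha, hfin, h, hh⟩ :=
    hP.exists_antisymplectic_isPolarizedIso_quotientBy_graphSubgroup' _ hV hVc hVo hVoc hGY hGZ
  exact ⟨V, hV, hVc, hVo, hVoc, GY, GZ, hGY, hGZ, p, hpb, ha, hfin, h, hh,
    hd.isPolarizationType_subtorusPeriod _ hV hVc⟩

/-! ## §2 The second factor is of the complementary type `δ̃ = (1^{g−2u}, δ)` (`2u ≤ g`) -/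

/-- **The complementary subvariety has the complementary type** (the Siegel torus `X_W`, `W ∈ NL_{g,δ}`,
`2u ≤ g`): a lattice subspace `V` with `E_W|_V` of type `δ = (d₁, …, d_u)` has `E_W|_{V^⊥}` of type
`δ̃ = (1, …, 1, d₁, …, d_u)` with `g − 2u` ones («It has dimension `g − u` and by [BL04], if `θ|_Y` is of type
`(d₁, …, d_u)` then `θ|_Z` is of type `δ̃`»; Lange's Cor. 5.3.5, tree
`IsPrincipalPolarization.exists_isSubPolarizationType_compl`, with the uniqueness of types).
[cite: IribarLopez2024NoetherLefschetzCycles, §2.2 (p. 7)] [cite: Lange2023AbelianVarietiesComplex, §5.3.1 Cor. 5.3.5 (p. 263)] -/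
theorem isSubPolarizationType_orthSubspace_append {δ : Fin u → ℕ} (h2u : 2 * u ≤ g) {W : siegelUpperHalfSpace g}
    {V : Submodule ℝ (Fin g ⊕ Fin g → ℝ)} (hV : IsLatticeSubspace V) (hVc : IsComplexSubspace (prinPeriod W) V)
    (hd : IsSubPolarizationType (prinPeriod W) (prinForm W) V δ) :
    IsSubPolarizationType (prinPeriod W) (prinForm W) (orthSubspace (prinPeriod W) (prinForm W) V)
      (Fin.append (fun _ : Fin (g - 2 * u) ↦ 1) δ) := by
  have hP := isPrincipalPolarization_prinForm W
  have hη := hP.isRiemannForm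
  set Φ := (prinPeriod W : (Fin g ⊕ Fin g → ℝ) ≃L[ℝ] (Fin g → ℂ)) with hΦ
  have hW : IsLatticeSubspace (orthSubspace Φ (prinForm W) V) := isLatticeSubspace_orthSubspace _ hη hV hVc
  have hWc : IsComplexSubspace Φ (orthSubspace Φ (prinForm W) V) := isComplexSubspace_orthSubspace _ hη.1 hVc
  have hVV : orthSubspace Φ (prinForm W) (orthSubspace Φ (prinForm W) V) = V := orthSubspace_orthSubspace Φ hη hVc
  have hVk := finrank_eq_of_isSubPolarizationType hV hd
  have hsum := finrank_add_finrank_orthSubspace Φ hη hVc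
  rw [Fintype.card_sum, Fintype.card_fin] at hsum
  have hdim : finrank ℝ (orthSubspace Φ (prinForm W) (orthSubspace Φ (prinForm W) V)) ≤
      finrank ℝ (orthSubspace Φ (prinForm W) V) := by
    rw [hVV]; omega
  obtain ⟨r, k, d, hd', -, happ, hkr⟩ := hP.exists_isSubPolarizationType_compl Φ hW hWc hdim
  rw [hVV] at hd'
  obtain ⟨hur, hδd⟩ := hd.unique Φ hη hV hVc hd'
  subst hur
  have hdδ : d = δ := (funext fun i ↦ by simpa using hδd i).symm
  subst hdδ
  have hk : k = g - 2 * u := by omega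
  subst hk
  exact happ

/-- **Iribar López 2024, Lemma 10 / Def. 4 with the complementary type** (`2u ≤ g`): for `W ∈ NL_{g,δ}` the
polarised torus `(X_W, E_W)` is isomorphic to a twisted product `((Y × Z)/graph(p), θ_p)` of its complementary
pair `(Y, Z) = (π(V), π(V^⊥))`, `p : K(θ_Y) → K(θ_Z)` bijective antisymplectic, with `(Y, θ_Y)` of type `δ`
AND `(Z, θ_Z)` of the complementary type `δ̃ = (1^{g−2u}, δ)` — the pair `((Y, θ_Y), (Z, θ_Z))` lies in the
domain `𝒜_{u,δ} × 𝒜_{g−u,δ̃}` of `𝒫_{g,δ}`. [cite: IribarLopez2024NoetherLefschetzCycles, §2.2 Lemma 10 and Def. 4 (pp. 7–8)] [cite: Lange2023AbelianVarietiesComplex, §5.3.1 Cor. 5.3.4–5.3.5, Lemma 5.3.6 (p. 263)] -/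
theorem exists_isPolarizedIso_quotientBy_graphSubgroup_of_mem_nlLocusType_compl {δ : Fin u → ℕ}
    (h2u : 2 * u ≤ g) {W : siegelUpperHalfSpace g} (hW : W ∈ nlLocusType g δ) :
    ∃ (V : Submodule ℝ (Fin g ⊕ Fin g → ℝ)) (hV : IsLatticeSubspace V) (hVc : IsComplexSubspace (prinPeriod W) V)
      (hVo : IsLatticeSubspace (orthSubspace (prinPeriod W) (prinForm W) V))
      (hVoc : IsComplexSubspace (prinPeriod W) (orthSubspace (prinPeriod W) (prinForm W) V))
      (GY : Matrix (Fin (subRank V)) (Fin (subRank V)) ℤ)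
      (GZ : Matrix (Fin (subRank (orthSubspace (prinPeriod W) (prinForm W) V)))
        (Fin (subRank (orthSubspace (prinPeriod W) (prinForm W) V))) ℤ)
      (_ : GY.map (Int.cast : ℤ → ℝ) = latticeGram (subtorusPeriod (prinPeriod W) V hV hVc)
        (pullbackForm (cxSpan (prinPeriod W) V).subtypeL (prinForm W)))
      (_ : GZ.map (Int.cast : ℤ → ℝ) =
        latticeGram (subtorusPeriod (prinPeriod W) (orthSubspace (prinPeriod W) (prinForm W) V) hVo hVoc)
          (pullbackForm (cxSpan (prinPeriod W) (orthSubspace (prinPeriod W) (prinForm W) V)).subtypeL (prinForm W)))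
      (p : kerPhiH (subtorusPeriod (prinPeriod W) V hV hVc) GY →+
        kerPhiH (subtorusPeriod (prinPeriod W) (orthSubspace (prinPeriod W) (prinForm W) V) hVo hVoc) GZ)
      (_ : Bijective p)
      (_ : IsAntisymplectic (pullbackForm (cxSpan (prinPeriod W) V).subtypeL (prinForm W))
        (pullbackForm (cxSpan (prinPeriod W) (orthSubspace (prinPeriod W) (prinForm W) V)).subtypeL (prinForm W)) p)
      (_ : Finite (graphSubgroup _ _ p))
      (h : ComplexTorus (prinPeriod W) ≃+
        ComplexTorus (quotientByPeriod (prodPeriod (subtorusPeriod (prinPeriod W) V hV hVc)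
          (subtorusPeriod (prinPeriod W) (orthSubspace (prinPeriod W) (prinForm W) V) hVo hVoc))
          (graphSubgroup _ _ p))),
      IsPolarizedIso (prinPeriod W) (prinForm W)
          (quotientByPeriod (prodPeriod (subtorusPeriod (prinPeriod W) V hV hVc)
            (subtorusPeriod (prinPeriod W) (orthSubspace (prinPeriod W) (prinForm W) V) hVo hVoc))
            (graphSubgroup _ _ p))
          (prodForm (pullbackForm (cxSpan (prinPeriod W) V).subtypeL (prinForm W))
            (pullbackForm (cxSpan (prinPeriod W) (orthSubspace (prinPeriod W) (prinForm W) V)).subtypeL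
              (prinForm W))) h ∧
        ComplexTorus.IsPolarizationType (subtorusPeriod (prinPeriod W) V hV hVc)
          (pullbackForm (cxSpan (prinPeriod W) V).subtypeL (prinForm W)) δ ∧
        ComplexTorus.IsPolarizationType
          (subtorusPeriod (prinPeriod W) (orthSubspace (prinPeriod W) (prinForm W) V) hVo hVoc)
          (pullbackForm (cxSpan (prinPeriod W) (orthSubspace (prinPeriod W) (prinForm W) V)).subtypeL (prinForm W))
          (Fin.append (fun _ : Fin (g - 2 * u) ↦ 1) δ) := by
  obtain ⟨V, hV, hVc, hd⟩ := hW
  have hP := isPrincipalPolarization_prinForm W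
  have hη := hP.isRiemannForm
  have hVo : IsLatticeSubspace (orthSubspace (prinPeriod W) (prinForm W) V) :=
    isLatticeSubspace_orthSubspace _ hη hV hVc
  have hVoc : IsComplexSubspace (prinPeriod W) (orthSubspace (prinPeriod W) (prinForm W) V) :=
    isComplexSubspace_orthSubspace _ hη.1 hVc
  obtain ⟨GY, hGY⟩ := (isRiemannForm_restrict _ hη hV hVc).exists_intMatrix_latticeGram
  obtain ⟨GZ, hGZ⟩ := (isRiemannForm_restrict _ hη hVo hVoc).exists_intMatrix_latticeGram
  obtain ⟨p, hpb, ha, hfin, h, hh⟩ :=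
    hP.exists_antisymplectic_isPolarizedIso_quotientBy_graphSubgroup' _ hV hVc hVo hVoc hGY hGZ
  exact ⟨V, hV, hVc, hVo, hVoc, GY, GZ, hGY, hGZ, p, hpb, ha, hfin, h, hh,
    hd.isPolarizationType_subtorusPeriod _ hV hVc,
    (isSubPolarizationType_orthSubspace_append h2u hV hVc hd).isPolarizationType_subtorusPeriod _ hVo hVoc⟩

/-! ## §3 `NL_{g,δ} = image(𝒫_{g,δ})` on `𝔥_g`: the characterisation -/

/-- **`NL_{g,δ}` is exactly the locus of twisted products with first factor of type `δ`** (Iribar López's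
«`𝒫_{g,δ}` is surjective onto the locus …» together with Lemma 10's «contains `(Y, θ_Y)` … as complementary
subvarieties»): `W ∈ NL_{g,δ}` iff `(X_W, E_W)` is isomorphic, as a polarised torus, to a Debarre twisted product
`((Y × Z)/graph(p), θ_p)` over a complementary pair `(Y, Z) = (π(V), π(V^⊥))` of `X_W` (`p : K(θ_Y) → K(θ_Z)`
bijective antisymplectic) with `(Y, θ_Y)` of type `δ`.  (`⇒` is §1; `⇐` is FILE C's
`mem_nlLocusType_of_isPolarizedIso_quotientBy_graphSubgroup`: the image `π(Y × 0)` of the first factor is an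
abelian subvariety of the twisted product with induced type `δ`, transported along the isomorphism.)
[cite: IribarLopez2024NoetherLefschetzCycles, §2.2 Lemma 10 and Def. 4 (pp. 7–8), §1.2 (p. 3)] [cite: Auffarth2016NonSimplePPAV, §3] -/
theorem mem_nlLocusType_iff_exists_isPolarizedIso_quotientBy_graphSubgroup {δ : Fin u → ℕ}
    {W : siegelUpperHalfSpace g} :
    W ∈ nlLocusType g δ ↔
    ∃ (V : Submodule ℝ (Fin g ⊕ Fin g → ℝ)) (hV : IsLatticeSubspace V) (hVc : IsComplexSubspace (prinPeriod W) V)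
      (hVo : IsLatticeSubspace (orthSubspace (prinPeriod W) (prinForm W) V))
      (hVoc : IsComplexSubspace (prinPeriod W) (orthSubspace (prinPeriod W) (prinForm W) V))
      (GY : Matrix (Fin (subRank V)) (Fin (subRank V)) ℤ)
      (GZ : Matrix (Fin (subRank (orthSubspace (prinPeriod W) (prinForm W) V)))
        (Fin (subRank (orthSubspace (prinPeriod W) (prinForm W) V))) ℤ)
      (_ : GY.map (Int.cast : ℤ → ℝ) = latticeGram (subtorusPeriod (prinPeriod W) V hV hVc)
        (pullbackForm (cxSpan (prinPeriod W) V).subtypeL (prinForm W)))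
      (_ : GZ.map (Int.cast : ℤ → ℝ) =
        latticeGram (subtorusPeriod (prinPeriod W) (orthSubspace (prinPeriod W) (prinForm W) V) hVo hVoc)
          (pullbackForm (cxSpan (prinPeriod W) (orthSubspace (prinPeriod W) (prinForm W) V)).subtypeL (prinForm W)))
      (p : kerPhiH (subtorusPeriod (prinPeriod W) V hV hVc) GY →+
        kerPhiH (subtorusPeriod (prinPeriod W) (orthSubspace (prinPeriod W) (prinForm W) V) hVo hVoc) GZ)
      (_ : Bijective p)
      (_ : IsAntisymplectic (pullbackForm (cxSpan (prinPeriod W) V).subtypeL (prinForm W))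
        (pullbackForm (cxSpan (prinPeriod W) (orthSubspace (prinPeriod W) (prinForm W) V)).subtypeL (prinForm W)) p)
      (_ : Finite (graphSubgroup _ _ p))
      (h : ComplexTorus (prinPeriod W) ≃+
        ComplexTorus (quotientByPeriod (prodPeriod (subtorusPeriod (prinPeriod W) V hV hVc)
          (subtorusPeriod (prinPeriod W) (orthSubspace (prinPeriod W) (prinForm W) V) hVo hVoc))
          (graphSubgroup _ _ p))),
      IsPolarizedIso (prinPeriod W) (prinForm W)
          (quotientByPeriod (prodPeriod (subtorusPeriod (prinPeriod W) V hV hVc)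
            (subtorusPeriod (prinPeriod W) (orthSubspace (prinPeriod W) (prinForm W) V) hVo hVoc))
            (graphSubgroup _ _ p))
          (prodForm (pullbackForm (cxSpan (prinPeriod W) V).subtypeL (prinForm W))
            (pullbackForm (cxSpan (prinPeriod W) (orthSubspace (prinPeriod W) (prinForm W) V)).subtypeL
              (prinForm W))) h ∧
        ComplexTorus.IsPolarizationType (subtorusPeriod (prinPeriod W) V hV hVc)
          (pullbackForm (cxSpan (prinPeriod W) V).subtypeL (prinForm W)) δ := by
  refine ⟨exists_isPolarizedIso_quotientBy_graphSubgroup_of_mem_nlLocusType, ?_⟩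
  rintro ⟨V, hV, hVc, hVo, hVoc, GY, GZ, hGY, hGZ, p, -, ha, hfin, h, hh, hδ⟩
  exact mem_nlLocusType_of_isPolarizedIso_quotientBy_graphSubgroup
    (isRiemannForm_restrict _ (isRiemannForm_prinForm W) hV hVc) hGY hGZ ha hδ hh.symm

/-- **Corollary: `NL_{g,δ}` and `NL_{g,δ̃}` are the same image** (`2u ≤ g`): a point of `NL_{g,δ̃}`,
`δ̃ = (1^{g−2u}, δ)`, is a twisted product with FIRST factor of type `δ` (grading by the small or the large
member of the complementary pair, `nlLocusType_append_eq`). [cite: IribarLopez2024NoetherLefschetzCycles, §2.2 (p. 7) and Lemma 10] [cite: Lange2023AbelianVarietiesComplex, §5.3.1 Cor. 5.3.5 (p. 263)] -/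
theorem exists_isPolarizedIso_quotientBy_graphSubgroup_of_mem_nlLocusType_append {δ : Fin u → ℕ}
    (h2u : 2 * u ≤ g) {W : siegelUpperHalfSpace g}
    (hW : W ∈ nlLocusType g (Fin.append (fun _ : Fin (g - 2 * u) ↦ 1) δ)) :
    ∃ (V : Submodule ℝ (Fin g ⊕ Fin g → ℝ)) (hV : IsLatticeSubspace V) (hVc : IsComplexSubspace (prinPeriod W) V)
      (hVo : IsLatticeSubspace (orthSubspace (prinPeriod W) (prinForm W) V))
      (hVoc : IsComplexSubspace (prinPeriod W) (orthSubspace (prinPeriod W) (prinForm W) V))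
      (GY : Matrix (Fin (subRank V)) (Fin (subRank V)) ℤ)
      (GZ : Matrix (Fin (subRank (orthSubspace (prinPeriod W) (prinForm W) V)))
        (Fin (subRank (orthSubspace (prinPeriod W) (prinForm W) V))) ℤ)
      (_ : GY.map (Int.cast : ℤ → ℝ) = latticeGram (subtorusPeriod (prinPeriod W) V hV hVc)
        (pullbackForm (cxSpan (prinPeriod W) V).subtypeL (prinForm W)))
      (_ : GZ.map (Int.cast : ℤ → ℝ) =
        latticeGram (subtorusPeriod (prinPeriod W) (orthSubspace (prinPeriod W) (prinForm W) V) hVo hVoc)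
          (pullbackForm (cxSpan (prinPeriod W) (orthSubspace (prinPeriod W) (prinForm W) V)).subtypeL (prinForm W)))
      (p : kerPhiH (subtorusPeriod (prinPeriod W) V hV hVc) GY →+
        kerPhiH (subtorusPeriod (prinPeriod W) (orthSubspace (prinPeriod W) (prinForm W) V) hVo hVoc) GZ)
      (_ : Bijective p)
      (_ : IsAntisymplectic (pullbackForm (cxSpan (prinPeriod W) V).subtypeL (prinForm W))
        (pullbackForm (cxSpan (prinPeriod W) (orthSubspace (prinPeriod W) (prinForm W) V)).subtypeL (prinForm W)) p)
      (_ : Finite (graphSubgroup _ _ p))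
      (h : ComplexTorus (prinPeriod W) ≃+
        ComplexTorus (quotientByPeriod (prodPeriod (subtorusPeriod (prinPeriod W) V hV hVc)
          (subtorusPeriod (prinPeriod W) (orthSubspace (prinPeriod W) (prinForm W) V) hVo hVoc))
          (graphSubgroup _ _ p))),
      IsPolarizedIso (prinPeriod W) (prinForm W)
          (quotientByPeriod (prodPeriod (subtorusPeriod (prinPeriod W) V hV hVc)
            (subtorusPeriod (prinPeriod W) (orthSubspace (prinPeriod W) (prinForm W) V) hVo hVoc))
            (graphSubgroup _ _ p))
          (prodForm (pullbackForm (cxSpan (prinPeriod W) V).subtypeL (prinForm W))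
            (pullbackForm (cxSpan (prinPeriod W) (orthSubspace (prinPeriod W) (prinForm W) V)).subtypeL
              (prinForm W))) h ∧
        ComplexTorus.IsPolarizationType (subtorusPeriod (prinPeriod W) V hV hVc)
          (pullbackForm (cxSpan (prinPeriod W) V).subtypeL (prinForm W)) δ ∧
        ComplexTorus.IsPolarizationType
          (subtorusPeriod (prinPeriod W) (orthSubspace (prinPeriod W) (prinForm W) V) hVo hVoc)
          (pullbackForm (cxSpan (prinPeriod W) (orthSubspace (prinPeriod W) (prinForm W) V)).subtypeL (prinForm W))
          (Fin.append (fun _ : Fin (g - 2 * u) ↦ 1) δ) :=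
  exists_isPolarizedIso_quotientBy_graphSubgroup_of_mem_nlLocusType_compl h2u (nlLocusType_append_eq δ h2u ▸ hW)

end SiegelModuli

end Literature.AlgebraicGeometry.ModuliOfAbelianVarieties

end
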